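import Summits.QuantumFields.YangMills.Theorems.UnitScaleTiltProp8HalvingQuarterMatrix
import Summits.QuantumFields.YangMills.Theorems.UnitScaleTiltProp8FlatHCurlCurlPairing
import Summits.QuantumFields.YangMills.Theorems.UnitScaleTiltProp8HalvingDressingLetterT3
import HarnessLib

/-!
# Route `UnitScaleTilt`, crux K1 child «MinimiserStabilityRegPr» (stmt-QuantumFields-19200), stub H `stub_halvingStep`, the (165)-A₁ row's dressing letter `C_E`:
# **THE ℝ → M₂ PORT OF (X1) AND (X2-CH)** — the `∂^{η*}∂^η`-sup row and the `∂^{η*}∂^η`-pairing letter of a scalar kernel operator `H` (P2's `flatH`) carried to its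
# KERNEL EXTENSION `𝔄_X(b) = Σ_c (He_c)(b)·X(c)` on `𝔤`∕M₂-valued index data, in the explicit curl–curl avatar
# `CC Z b = ((η:ℂ)²)⁻¹·Σ_p σ(p,b)·Φ_p(Z)` of the M2 knit (✓ `HalvingDressingLetter.exists_hWq_dressed_cubeSeq_T3`'s `hX1`∕`hCH` binders)

Cell `ym3-torus` (HUMAN RULING D-0037, YM ladder rung R3), width seat `ym-ust-19936-w3` gen 4 (★★OWNER ym3-torus-plan g26 ASSIGNMENTS 14 (6), RULING g26-№6 (S5):
«H := flatH for the ♭ chart»).  `--supports stmt-QuantumFields-19200 --as helper`; count-neutral; def-free.  Serves item 19936 `HistoryTailL` only through (T).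

WHY.  The scalar letters are in the tree — (X1) `FlatHCurlCurlSupRow.curlCurlSupRow_of_kernelRows` ∕ `FlatPortCurlCurlSupRowL0.curlCurlSupRow_of_adm22`, (X2-CH)
`FlatHCurlCurlPairing.curlCurlPairing_of_row2` ∕ `FlatPortCurlCurlPairingL0.curlCurlPairing_of_adm22` — for REAL index data and the ℓ²-operator `dcsE η⁻¹ ∘ dcE η⁻¹`;
the M2 knit reads them on M₂-valued data through the explicit `CC`.  This file is the pure bridge (no kernel row, no geometry): every norm-dominated real reading
`M ↦ r·Re(u·f M)` of `CC(𝔄_X)(b)` IS the scalar `∂^{η*}∂^η(H(reading∘X))(b)` (`HalvingQuarterMatrix.reFunctional_kernel` + the explicit plaquette formula of `dcsE∘dcE`),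
so the scalar letters transfer by duality (`norm_le_of_forall_reFunctional`) with the SAME constants (pairing: factor `2` from `‖tr(AB)‖ ≤ 2‖A‖‖B‖` on M₂).

WHAT IS PROVED (sorry-free; axioms standard; no definition).  `P` any `Params` ∕ the d = 3 carrier `F.P K`; `H : (BondIdx D → ℝ) →ₗ[ℝ] (PBond P 0 → ℝ)` any scalar operator:
* §1 `curl_single`, ★ `dcsE_dcE_apply_sum_plaq` — `(∂*∂v)(b) = Σ_p (∂v)(p)·(c·σ(p,b))` (the explicit plaquette form of the adjoint composite, from
  `FlatHCurlCurlPairing.sum_dcsE_dcE_mul_eq`);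
* §2 ★ `re_reading_curlCurl` — for every reading: `r·Re(u·f(CC 𝔄 b)) = (dcsE η⁻¹ (dcE η⁻¹ (reading ∘ 𝔄)))(b)`; with `reFunctional_kernel`:
  `= (∂^{η*}∂^η H(reading ∘ X))(b)` for the kernel extension;
* §3 ★★ **`matrix_curlCurlSupRow`** — (X1)ᴹ: the scalar row `∀ Y t, 0 ≤ t → (∀ c, |Y c| ≤ t) → ∀ b, w₃(b)·|(∂^{η*}∂^ηHY)(b)| ≤ B·t` implies, for every M₂-valued `X` with
  `‖X c‖ ≤ t` and `𝔄 b = Σ_c (He_c)(b)•X c`: `w₃(b)·‖CC 𝔄 b‖ ≤ B·t` — LITERALLY the `hX1` binder shape of the M2 knit at `H X := 𝔄_X`;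
* §4 ★★ **`matrix_curlCurlPairing`** — (X2-CH)ᴹ: the scalar pairing letter `∀ Zr s, 0 ≤ s → (gradient letter of Zr ≤ s) → ∀ Y, |Σ_b (∂^{η*}∂^ηHY)(b)·Zr(b)| ≤ B·s·Σ_c u(c)|Y c|`
  (`u ≥ 0`, `w₂ ≥ 0`) implies, for M₂-valued `Z` with gradient letter `≤ s` and every `X`: `‖Σ_b tr(CC 𝔄_X b · Z b)‖ ≤ 2B·s·Σ_c u(c)‖X c‖` — the `hCH` shape.
HONEST SCOPE: linear algebra and duality on `M₂(ℂ)`; no estimate proved here; NOT a claim about the mass gap.  YM₃ on the three-torus is rung R3, not the Clay problem.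

References: T. Bałaban, CMP **102** (1985) 277–309 [Balaban1985Variational] (88) p.291, (157) p.302, (161)–(163) p.303; CMP **96** (1984) 223–250 [Balaban1984PropagatorsII]
(2.18)–(2.19) p.226, Cor. 2.8 (2.150)–(2.151) p.249; CMP **95** (1984) 17–40 [Balaban1984PropagatorsI] (1.2) p.18.
-/

set_option autoImplicit false

noncomputable section

open scoped BigOperators Matrix.Norms.L2Operator

namespace Summit.QuantumFields.YangMills.Theorems.FlatHCurlCurlMatrix

open Literature.MathematicalPhysics.QuantumFieldTheory.Balaban1983to89
open LatticeFieldCalculus (curl)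
open B6SectADomainsV1 (Domains)
open B6SectAOperatorsV1 (BondIdx dcE dcsE)
open T3ContinuumYM3Torus (T3Family)
open FlatHCurlCurlPairing (sum_dcsE_dcE_mul_eq)
open HalvingQuarterMatrix (norm_le_of_forall_reFunctional reFunctional_kernel)
open HalvingDressingLetter (curlCurl_pairing_symm)
open FlatPlaqDeriv (norm_trace_mul_le)

/-! ## §1 The explicit plaquette form of `∂^{η*}∂^η` -/

section Scalar

variable {P : Params}

/-- the curl of the indicator of a bond is `c·σ(p,b)` (the incidence sign of `b` in `p`). [cite: Balaban1984PropagatorsI, (1.2) p.18] -/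
theorem curl_single [DecidableEq (PBond P 0)] (c : ℝ) (b : PBond P 0) (p : Plaq P 0) :
    curl c (Pi.single b (1 : ℝ) : PBond P 0 → ℝ) p =
      c * ((Pi.single b (1 : ℝ) : PBond P 0 → ℝ) ⟨p.src, p.μ⟩ + (Pi.single b (1 : ℝ) : PBond P 0 → ℝ) ⟨p.src.shift p.μ, p.ν⟩ -
        (Pi.single b (1 : ℝ) : PBond P 0 → ℝ) ⟨p.src.shift p.ν, p.μ⟩ - (Pi.single b (1 : ℝ) : PBond P 0 → ℝ) ⟨p.src, p.ν⟩) := by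
  unfold curl; rw [smul_eq_mul]

/-- ★ **THE EXPLICIT PLAQUETTE FORM OF `∂^{η*}∂^η`**: `(∂*∂v)(b) = Σ_p (∂_c v)(p)·(c·σ(p,b))` (pair `∂*∂v` against the indicator of `b`; summation by parts
`FlatHCurlCurlPairing.sum_dcsE_dcE_mul_eq`). [cite: Balaban1984PropagatorsII, (2.18)-(2.19) p.226; Balaban1984PropagatorsI, (1.2) p.18] -/
theorem dcsE_dcE_apply_sum_plaq [DecidableEq (PBond P 0)] (c : ℝ) (v : PBond P 0 → ℝ) (b : PBond P 0) :
    (dcsE (P := P) c (dcE c (WithLp.toLp 2 v))) b =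
      ∑ p : Plaq P 0, curl c v p *
        (c * ((Pi.single b (1 : ℝ) : PBond P 0 → ℝ) ⟨p.src, p.μ⟩ + (Pi.single b (1 : ℝ) : PBond P 0 → ℝ) ⟨p.src.shift p.μ, p.ν⟩ -
          (Pi.single b (1 : ℝ) : PBond P 0 → ℝ) ⟨p.src.shift p.ν, p.μ⟩ - (Pi.single b (1 : ℝ) : PBond P 0 → ℝ) ⟨p.src, p.ν⟩)) := by
  have h := sum_dcsE_dcE_mul_eq (P := P) c v (Pi.single b (1 : ℝ))
  rw [Finset.sum_eq_single b (fun b' _ hb' => by rw [Pi.single_eq_of_ne hb', mul_zero])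
    (fun hb => absurd (Finset.mem_univ b) hb), Pi.single_eq_same, mul_one] at h
  rw [h]
  exact Finset.sum_congr rfl fun p _ => by rw [curl_single]

/-- the complex indicator is the coercion of the real one. [folklore] -/
theorem single_complex_apply [DecidableEq (PBond P 0)] (b q : PBond P 0) :
    (Pi.single b (1 : ℂ) : PBond P 0 → ℂ) q = (((Pi.single b (1 : ℝ) : PBond P 0 → ℝ) q : ℝ) : ℂ) := by
  by_cases h : q = b
  · subst h; simp
  · simp [Pi.single_eq_of_ne h]

end Scalar

/-! ## §2 Real readings of the explicit curl–curl commute with the scalar `∂^{η*}∂^η` -/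

section Reading

variable {P : Params} {N : ℕ}

/-- ★ **READINGS COMMUTE WITH THE CURL–CURL**: for every real reading `M ↦ r·Re(u·f M)` of `M_N(ℂ)` and every field `𝔄`, the reading of the explicit curl–curl
`((η:ℂ)²)⁻¹·Σ_p σ(p,b)·Φ_p(𝔄)` at `b` is the scalar `(dcsE η⁻¹ (dcE η⁻¹ (reading ∘ 𝔄)))(b)` (`η⁻¹ := c`, `η = c⁻¹`).
[cite: Balaban1984PropagatorsII, (2.18)-(2.19) p.226; Balaban1984PropagatorsI, (1.2) p.18] -/
theorem re_reading_curlCurl [DecidableEq (PBond P 0)] {c e : ℝ} (he : e = c⁻¹) (f : StrongDual ℂ (Matrix (Fin N) (Fin N) ℂ)) (u : ℂ) (r : ℝ)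
    (𝔄 : PBond P 0 → Matrix (Fin N) (Fin N) ℂ) (b : PBond P 0) :
    r * (u * f ((((e : ℝ) : ℂ) ^ 2)⁻¹ • ∑ p : Plaq P 0,
        ((Pi.single b (1 : ℂ) : PBond P 0 → ℂ) ⟨p.src, p.μ⟩ + (Pi.single b (1 : ℂ) : PBond P 0 → ℂ) ⟨p.src.shift p.μ, p.ν⟩ -
          (Pi.single b (1 : ℂ) : PBond P 0 → ℂ) ⟨p.src.shift p.ν, p.μ⟩ - (Pi.single b (1 : ℂ) : PBond P 0 → ℂ) ⟨p.src, p.ν⟩) •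
        (𝔄 ⟨p.src, p.μ⟩ + 𝔄 ⟨p.src.shift p.μ, p.ν⟩ - 𝔄 ⟨p.src.shift p.ν, p.μ⟩ - 𝔄 ⟨p.src, p.ν⟩))).re =
      (dcsE (P := P) c (dcE c (WithLp.toLp 2 (fun b' : PBond P 0 => r * (u * f (𝔄 b')).re)))) b := by
  -- the reading and its algebra
  set g : Matrix (Fin N) (Fin N) ℂ → ℝ := fun M => r * (u * f M).re with hg
  have g_add : ∀ A B : Matrix (Fin N) (Fin N) ℂ, g (A + B) = g A + g B := by
    intro A B; simp only [hg, map_add, mul_add, Complex.add_re]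
  have g_sub : ∀ A B : Matrix (Fin N) (Fin N) ℂ, g (A - B) = g A - g B := by
    intro A B; simp only [hg, map_sub, mul_sub, Complex.sub_re]
  have g_smul : ∀ (s : ℝ) (A : Matrix (Fin N) (Fin N) ℂ), g ((s : ℂ) • A) = s * g A := by
    intro s A
    simp only [hg]
    rw [map_smul, smul_eq_mul, mul_left_comm u, Complex.re_ofReal_mul]
    ring
  have g_sum : ∀ (G : Plaq P 0 → Matrix (Fin N) (Fin N) ℂ), g (∑ p, G p) = ∑ p, g (G p) := by
    intro G
    simp only [hg]
    rw [map_sum, Finset.mul_sum, Complex.re_sum, Finset.mul_sum]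
  -- the prefactor and the signs are real
  have hpref : (((e : ℝ) : ℂ) ^ 2)⁻¹ = (((c ^ 2 : ℝ)) : ℂ) := by
    rw [he]
    push_cast
    rw [inv_pow, inv_inv]
  set σ : Plaq P 0 → ℝ := fun p => (Pi.single b (1 : ℝ) : PBond P 0 → ℝ) ⟨p.src, p.μ⟩ + (Pi.single b (1 : ℝ) : PBond P 0 → ℝ) ⟨p.src.shift p.μ, p.ν⟩ -
    (Pi.single b (1 : ℝ) : PBond P 0 → ℝ) ⟨p.src.shift p.ν, p.μ⟩ - (Pi.single b (1 : ℝ) : PBond P 0 → ℝ) ⟨p.src, p.ν⟩ with hσ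
  have hsign : ∀ p : Plaq P 0,
      ((Pi.single b (1 : ℂ) : PBond P 0 → ℂ) ⟨p.src, p.μ⟩ + (Pi.single b (1 : ℂ) : PBond P 0 → ℂ) ⟨p.src.shift p.μ, p.ν⟩ -
          (Pi.single b (1 : ℂ) : PBond P 0 → ℂ) ⟨p.src.shift p.ν, p.μ⟩ - (Pi.single b (1 : ℂ) : PBond P 0 → ℂ) ⟨p.src, p.ν⟩) = ((σ p : ℝ) : ℂ) := by
    intro p
    simp only [hσ, single_complex_apply]
    push_cast
    ring
  -- rewrite the matrix expression with real scalars and read it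
  show g _ = _
  rw [hpref, Finset.sum_congr rfl fun p _ => by rw [hsign p], g_smul, g_sum]
  simp only [g_smul, g_sub, g_add]
  -- the scalar side
  rw [dcsE_dcE_apply_sum_plaq, Finset.mul_sum]
  refine Finset.sum_congr rfl fun p _ => ?_
  simp only [hσ, hg]
  unfold curl
  rw [smul_eq_mul]
  ring

/-- `∂^{η*}∂^η` is symmetric for the plain ℓ² pairing: `Σ_b v(b)·(∂*∂z)(b) = Σ_b (∂*∂v)(b)·z(b)`. [cite: Balaban1984PropagatorsII, (2.18)-(2.19) p.226] -/
theorem sum_mul_dcsE_dcE_comm (c : ℝ) (v z : PBond P 0 → ℝ) :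
    ∑ b, v b * (dcsE (P := P) c (dcE c (WithLp.toLp 2 z))) b = ∑ b, (dcsE (P := P) c (dcE c (WithLp.toLp 2 v))) b * z b := by
  have h1 : ∑ b, v b * (dcsE (P := P) c (dcE c (WithLp.toLp 2 z))) b = ∑ b, (dcsE (P := P) c (dcE c (WithLp.toLp 2 z))) b * v b :=
    Finset.sum_congr rfl fun b _ => mul_comm _ _
  rw [h1, sum_dcsE_dcE_mul_eq c z v, sum_dcsE_dcE_mul_eq c v z]
  exact Finset.sum_congr rfl fun p _ => mul_comm _ _

end Reading

/-! ## §3 (X1)ᴹ: the `∂^{η*}∂^η`-sup row on M₂-valued data -/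

section MatrixRows

variable {F : T3Family} {n K : ℕ} {D : Domains (F.P K)} {w : ℕ → PBond (F.P K) 0 → ℝ} {H : (BondIdx D → ℝ) →ₗ[ℝ] (PBond (F.P K) 0 → ℝ)}

/-- ★★ **(X1)ᴹ — THE `∂^{η*}∂^η`-SUP ROW OF THE KERNEL EXTENSION ON M₂-VALUED DATA**: if the scalar operator `H` has the plain-sup `∂^{η*}∂^η` row with constant `B ≥ 0`
(✓ `FlatHCurlCurlSupRow.curlCurlSupRow_of_kernelRows` ∕ `FlatPortCurlCurlSupRowL0.curlCurlSupRow_of_adm22`), then for every M₂-valued `X` with `‖X c‖ ≤ t` and its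
kernel extension `HM X b = Σ_c (He_c)(b)•X c`: `w₃(b)·‖CC(HM X)(b)‖ ≤ B·t` in the explicit curl–curl of the M2 knit — LITERALLY its `hX1` binder at `H X := HM X`.
[cite: Balaban1985Variational, (88) p.291, (157) p.302, (161) p.303; Balaban1984PropagatorsII, Cor. 2.8 (2.151) p.249] -/
theorem matrix_curlCurlSupRow {B : ℝ} (hB : 0 ≤ B) (hw3 : ∀ b, 0 < w 3 b)
    (hX1 : ∀ (Y : BondIdx D → ℝ) (t : ℝ), 0 ≤ t → (∀ c, |Y c| ≤ t) → ∀ b : PBond (F.P K) 0,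
      w 3 b * |(dcsE ((F.L : ℝ) ^ (K - n)) (dcE ((F.L : ℝ) ^ (K - n)) (WithLp.toLp 2 (H Y)))) b| ≤ B * t)
    (HM : (BondIdx D → Matrix (Fin 2) (Fin 2) ℂ) → (PBond (F.P K) 0 → Matrix (Fin 2) (Fin 2) ℂ))
    (hHM : ∀ X b, HM X b = ∑ c, H (Pi.single c 1) b • X c) :
    ∀ (X : BondIdx D → Matrix (Fin 2) (Fin 2) ℂ) (t : ℝ), 0 ≤ t → (∀ c, ‖X c‖ ≤ t) → ∀ b : PBond (F.P K) 0,
      w 3 b * ‖((((((F.L : ℝ)⁻¹) ^ (K - n)) : ℝ) : ℂ) ^ 2)⁻¹ • ∑ p : Plaq (F.P K) 0,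
          ((Pi.single b (1 : ℂ) : PBond (F.P K) 0 → ℂ) ⟨p.src, p.μ⟩ + (Pi.single b (1 : ℂ) : PBond (F.P K) 0 → ℂ) ⟨p.src.shift p.μ, p.ν⟩ -
              (Pi.single b (1 : ℂ) : PBond (F.P K) 0 → ℂ) ⟨p.src.shift p.ν, p.μ⟩ - (Pi.single b (1 : ℂ) : PBond (F.P K) 0 → ℂ) ⟨p.src, p.ν⟩) •
            (HM X ⟨p.src, p.μ⟩ + HM X ⟨p.src.shift p.μ, p.ν⟩ - HM X ⟨p.src.shift p.ν, p.μ⟩ - HM X ⟨p.src, p.ν⟩)‖ ≤ B * t := by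
  classical
  intro X t ht hX b
  have hwb := hw3 b
  have he : ((F.L : ℝ)⁻¹) ^ (K - n) = ((F.L : ℝ) ^ (K - n))⁻¹ := inv_pow _ _
  rw [mul_comm, ← le_div_iff₀ hwb]
  refine norm_le_of_forall_reFunctional _ (div_nonneg (mul_nonneg hB ht) hwb.le) fun f u r hg => ?_
  -- the reading of the curl–curl is the scalar `∂*∂` of the reading, and the reading of `HM X` is `H` of the reading of `X`
  rw [re_reading_curlCurl he f u r (HM X) b]
  have hfun : (fun b' : PBond (F.P K) 0 => r * (u * f (HM X b')).re) = H (fun c => r * (u * f (X c)).re) :=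
    funext fun b' => reFunctional_kernel H (hHM X) f u r b'
  rw [hfun]
  have hY : ∀ c, |r * (u * f (X c)).re| ≤ t := fun c => (hg (X c)).trans (hX c)
  have h := hX1 (fun c => r * (u * f (X c)).re) t ht hY b
  rw [le_div_iff₀ hwb, mul_comm]
  exact (mul_le_mul_of_nonneg_left (le_abs_self _) hwb.le).trans h

/-! ## §4 (X2-CH)ᴹ: the `∂^{η*}∂^η`-pairing letter on M₂-valued data -/

/-- ★★ **(X2-CH)ᴹ — THE `∂^{η*}∂^η`-PAIRING LETTER OF THE KERNEL EXTENSION ON M₂-VALUED DATA**: if the scalar operator `H` has the pairing letter with constant `B` and index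
weight `u ≥ 0` (✓ `FlatHCurlCurlPairing.curlCurlPairing_of_row2` ∕ `FlatPortCurlCurlPairingL0.curlCurlPairing_of_adm22`, whose `Z` needs only the gradient letter), then for every
M₂-valued field `Z` with `w₂(b)·η⁻¹·‖Z(b+e_ν) − Z(b)‖ ≤ s` (`s ≥ 0`) and every M₂-valued `X`: `‖Σ_b tr(CC(HM X)(b)·Z(b))‖ ≤ 2B·s·Σ_c u(c)‖X c‖` — the `hCH` binder shape of
`DressingTransposeLetters.X2a_of_X2D_CCHt` ∕ the M2 knit at `H X := HM X` (symmetry of `CC` + duality per index bond + `‖tr(AB)‖ ≤ 2‖A‖‖B‖`).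
[cite: Balaban1985Variational, (88) p.291, (161)-(163) p.303; Balaban1984PropagatorsII, (2.18)-(2.19) p.226, Cor. 2.8 (2.151) p.249] -/
theorem matrix_curlCurlPairing {B : ℝ} {u : BondIdx D → ℝ} (hB : 0 ≤ B) (hu : ∀ c, 0 ≤ u c) (hw2 : ∀ b, 0 ≤ w 2 b)
    (hCH : ∀ (Zr : PBond (F.P K) 0 → ℝ) (s : ℝ), 0 ≤ s →
      (∀ (b : PBond (F.P K) 0) (ν : Fin (F.P K).d), w 2 b * (F.L : ℝ) ^ (K - n) * |Zr ⟨b.src.shift ν, b.dir⟩ - Zr b| ≤ s) →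
      ∀ Y : BondIdx D → ℝ, |∑ b, (dcsE ((F.L : ℝ) ^ (K - n)) (dcE ((F.L : ℝ) ^ (K - n)) (WithLp.toLp 2 (H Y)))) b * Zr b| ≤ B * s * ∑ c, u c * |Y c|)
    (HM : (BondIdx D → Matrix (Fin 2) (Fin 2) ℂ) → (PBond (F.P K) 0 → Matrix (Fin 2) (Fin 2) ℂ))
    (hHM : ∀ X b, HM X b = ∑ c, H (Pi.single c 1) b • X c) :
    ∀ (Z : PBond (F.P K) 0 → Matrix (Fin 2) (Fin 2) ℂ) (s : ℝ), 0 ≤ s →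
      (∀ (b : PBond (F.P K) 0) (ν : Fin (F.P K).d), w 2 b * (F.L : ℝ) ^ (K - n) * ‖Z ⟨b.src.shift ν, b.dir⟩ - Z b‖ ≤ s) →
      ∀ X : BondIdx D → Matrix (Fin 2) (Fin 2) ℂ,
        ‖∑ b : PBond (F.P K) 0, Matrix.trace ((((((((F.L : ℝ)⁻¹) ^ (K - n)) : ℝ) : ℂ) ^ 2)⁻¹ • ∑ p : Plaq (F.P K) 0,
          ((Pi.single b (1 : ℂ) : PBond (F.P K) 0 → ℂ) ⟨p.src, p.μ⟩ + (Pi.single b (1 : ℂ) : PBond (F.P K) 0 → ℂ) ⟨p.src.shift p.μ, p.ν⟩ -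
              (Pi.single b (1 : ℂ) : PBond (F.P K) 0 → ℂ) ⟨p.src.shift p.ν, p.μ⟩ - (Pi.single b (1 : ℂ) : PBond (F.P K) 0 → ℂ) ⟨p.src, p.ν⟩) •
            (HM X ⟨p.src, p.μ⟩ + HM X ⟨p.src.shift p.μ, p.ν⟩ - HM X ⟨p.src.shift p.ν, p.μ⟩ - HM X ⟨p.src, p.ν⟩)) * Z b)‖ ≤
          2 * B * s * ∑ c, u c * ‖X c‖ := by
  classical
  intro Z s hs hZ X
  have he : ((F.L : ℝ)⁻¹) ^ (K - n) = ((F.L : ℝ) ^ (K - n))⁻¹ := inv_pow _ _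
  -- abbreviate the curl–curl of `Z`
  set CZ : PBond (F.P K) 0 → Matrix (Fin 2) (Fin 2) ℂ := fun b => ((((((F.L : ℝ)⁻¹) ^ (K - n)) : ℝ) : ℂ) ^ 2)⁻¹ • ∑ p : Plaq (F.P K) 0,
          ((Pi.single b (1 : ℂ) : PBond (F.P K) 0 → ℂ) ⟨p.src, p.μ⟩ + (Pi.single b (1 : ℂ) : PBond (F.P K) 0 → ℂ) ⟨p.src.shift p.μ, p.ν⟩ -
              (Pi.single b (1 : ℂ) : PBond (F.P K) 0 → ℂ) ⟨p.src.shift p.ν, p.μ⟩ - (Pi.single b (1 : ℂ) : PBond (F.P K) 0 → ℂ) ⟨p.src, p.ν⟩) •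
            (Z ⟨p.src, p.μ⟩ + Z ⟨p.src.shift p.μ, p.ν⟩ - Z ⟨p.src.shift p.ν, p.μ⟩ - Z ⟨p.src, p.ν⟩) with hCZ
  -- symmetry: move the curl–curl onto `Z`
  rw [curlCurl_pairing_symm (((F.L : ℝ)⁻¹) ^ (K - n)) (HM X) Z]
  -- expand `HM X b = Σ_c (He_c)(b)•X c` and exchange the sums: `Σ_b tr(CZ_b·HM X_b) = Σ_c tr(W_c·X_c)`
  set W : BondIdx D → Matrix (Fin 2) (Fin 2) ℂ := fun c => ∑ b : PBond (F.P K) 0, H (Pi.single c 1) b • CZ b with hW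
  have hexp : ∑ b : PBond (F.P K) 0, Matrix.trace (CZ b * HM X b) = ∑ c, Matrix.trace (W c * X c) := by
    have h1 : ∀ b : PBond (F.P K) 0, Matrix.trace (CZ b * HM X b) = ∑ c, H (Pi.single c 1) b • Matrix.trace (CZ b * X c) := by
      intro b
      rw [hHM X b, Matrix.mul_sum, Matrix.trace_sum]
      exact Finset.sum_congr rfl fun c _ => by rw [Matrix.mul_smul, Matrix.trace_smul]
    rw [Finset.sum_congr rfl fun b _ => h1 b, Finset.sum_comm]
    refine Finset.sum_congr rfl fun c _ => ?_
    rw [hW]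
    simp only [Finset.sum_mul, Matrix.smul_mul, Matrix.trace_sum, Matrix.trace_smul]
  change ‖∑ b : PBond (F.P K) 0, Matrix.trace (CZ b * HM X b)‖ ≤ _
  rw [hexp]
  -- each `W_c` by duality: its readings are scalar pairings `⟨∂*∂(He_c), reading∘Z⟩`
  have hWc : ∀ c, ‖W c‖ ≤ B * s * u c := by
    intro c
    refine norm_le_of_forall_reFunctional _ (mul_nonneg (mul_nonneg hB hs) (hu c)) fun f u' r hg => ?_
    -- the reading of `W c`
    have hread : r * (u' * f (W c)).re = ∑ b : PBond (F.P K) 0, H (Pi.single c 1) b * (r * (u' * f (CZ b)).re) := by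
      simp only [hW, map_sum, Finset.mul_sum, Complex.re_sum]
      refine Finset.sum_congr rfl fun b _ => ?_
      rw [ContinuousLinearMap.map_smul_of_tower, Complex.real_smul, mul_left_comm u', Complex.re_ofReal_mul]
      ring
    have hcz : ∀ b : PBond (F.P K) 0, r * (u' * f (CZ b)).re =
        (dcsE ((F.L : ℝ) ^ (K - n)) (dcE ((F.L : ℝ) ^ (K - n)) (WithLp.toLp 2 (fun b' : PBond (F.P K) 0 => r * (u' * f (Z b')).re)))) b :=
      fun b => re_reading_curlCurl he f u' r Z b
    rw [hread, Finset.sum_congr rfl fun b _ => by rw [hcz b], sum_mul_dcsE_dcE_comm]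
    -- the scalar pairing letter at `Y := e_c`, `Zr := reading ∘ Z`
    have hZr : ∀ (b : PBond (F.P K) 0) (ν : Fin (F.P K).d),
        w 2 b * (F.L : ℝ) ^ (K - n) * |r * (u' * f (Z ⟨b.src.shift ν, b.dir⟩)).re - r * (u' * f (Z b)).re| ≤ s := by
      intro b ν
      have hdiff : r * (u' * f (Z ⟨b.src.shift ν, b.dir⟩)).re - r * (u' * f (Z b)).re = r * (u' * f (Z ⟨b.src.shift ν, b.dir⟩ - Z b)).re := by
        rw [map_sub, mul_sub, Complex.sub_re, mul_sub]
      rw [hdiff]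
      have hw2' : 0 ≤ w 2 b * (F.L : ℝ) ^ (K - n) := mul_nonneg (hw2 b) (pow_nonneg (Nat.cast_nonneg _) _)
      exact (mul_le_mul_of_nonneg_left (hg _) hw2').trans (hZ b ν)
    have key := hCH (fun b' => r * (u' * f (Z b')).re) s hs hZr (Pi.single c 1)
    have hsingle : ∑ c', u c' * |(Pi.single c (1 : ℝ) : BondIdx D → ℝ) c'| = u c := by
      rw [Finset.sum_eq_single c (fun c' _ hc' => by rw [Pi.single_eq_of_ne hc', abs_zero, mul_zero]) (fun h => absurd (Finset.mem_univ c) h),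
        Pi.single_eq_same, abs_one, mul_one]
    rw [hsingle] at key
    exact (le_abs_self _).trans key
  -- assemble
  calc ‖∑ c, Matrix.trace (W c * X c)‖ ≤ ∑ c, ‖Matrix.trace (W c * X c)‖ := norm_sum_le _ _
    _ ≤ ∑ c, 2 * ‖W c‖ * ‖X c‖ := Finset.sum_le_sum fun c _ => norm_trace_mul_le _ _
    _ ≤ ∑ c, 2 * (B * s * u c) * ‖X c‖ := Finset.sum_le_sum fun c _ =>
        mul_le_mul_of_nonneg_right (mul_le_mul_of_nonneg_left (hWc c) (by norm_num)) (norm_nonneg _)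
    _ = 2 * B * s * ∑ c, u c * ‖X c‖ := by rw [Finset.mul_sum]; exact Finset.sum_congr rfl fun c _ => by ring

end MatrixRows

/-! ## §5 The kernel extension as a ℂ-linear map; the ℓ¹-column letter (X2-H)ᴹ by the triangle inequality
(appended for the M2 knit's `H : (β′ → M₂) →ₗ[ℂ] (ι → M₂)` binder and ★w8-19200 g0's `l1_column_of_kernel`) -/

section KernelExt

variable {F : T3Family} {n K : ℕ} {D : Domains (F.P K)} {w : ℕ → PBond (F.P K) 0 → ℝ}

/-- **THE KERNEL EXTENSION IS (THE COERCION OF) A ℂ-LINEAR MAP**: for every scalar `H` there is `HL : (BondIdx D → M₂) →ₗ[ℂ] (PBond → M₂)` with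
`HL X b = Σ_c (He_c)(b)•X c` — so the M2 knit's ℂ-linear binder `H` instantiates at the kernel extension of `flatH` and `hHM` holds by this equation.
[cite: Balaban1985Variational, (157) p.302, (161) p.303] -/
theorem exists_linearMap_kernelExt (H : (BondIdx D → ℝ) →ₗ[ℝ] (PBond (F.P K) 0 → ℝ)) :
    ∃ HL : (BondIdx D → Matrix (Fin 2) (Fin 2) ℂ) →ₗ[ℂ] (PBond (F.P K) 0 → Matrix (Fin 2) (Fin 2) ℂ),
      ∀ (X : BondIdx D → Matrix (Fin 2) (Fin 2) ℂ) (b : PBond (F.P K) 0), HL X b = ∑ c, H (Pi.single c 1) b • X c := by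
  classical
  refine ⟨{ toFun := fun X b => ∑ c, H (Pi.single c 1) b • X c, map_add' := fun X Y => ?_, map_smul' := fun z X => ?_ }, fun X b => rfl⟩
  · funext b
    simp only [Pi.add_apply, smul_add, Finset.sum_add_distrib]
  · funext b
    simp only [Pi.smul_apply, RingHom.id_apply, Finset.smul_sum]
    exact Finset.sum_congr rfl fun c _ => (smul_comm z (H (Pi.single c 1) b) (X c)).symm

/-- ★ **(X2-H)ᴹ — THE ℓ¹-COLUMN LETTER OF THE KERNEL EXTENSION ON M₂-VALUED DATA**: a transposed column row `Σ_b v(b)·|(He_c)(b)| ≤ K(c)` of the scalar kernel (✓ ★w8-19200 g0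
`flatH_column_of_adm22` ∕ `FlatPortColumnSumL0.colSum_domT` with (k1)) gives, for `v ≥ 0` and `HM X b = Σ_c (He_c)(b)•X c`: `Σ_b v(b)·‖HM X b‖ ≤ Σ_c K(c)·‖X c‖`
(triangle inequality entry by entry — the `hHcol` shape of the M2 knit at the kernel extension). [cite: Balaban1985Variational, (88) p.291, (161)-(163) p.303; Balaban1984PropagatorsII, Cor. 2.8 (2.150) p.249] -/
theorem matrix_l1Column_of_kernelColumn {H : (BondIdx D → ℝ) →ₗ[ℝ] (PBond (F.P K) 0 → ℝ)} {v : PBond (F.P K) 0 → ℝ} (hv : ∀ b, 0 ≤ v b)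
    {Kc : BondIdx D → ℝ} (hcol : ∀ c, ∑ b, v b * |H (Pi.single c 1) b| ≤ Kc c)
    (HM : (BondIdx D → Matrix (Fin 2) (Fin 2) ℂ) → (PBond (F.P K) 0 → Matrix (Fin 2) (Fin 2) ℂ))
    (hHM : ∀ X b, HM X b = ∑ c, H (Pi.single c 1) b • X c) (X : BondIdx D → Matrix (Fin 2) (Fin 2) ℂ) :
    ∑ b, v b * ‖HM X b‖ ≤ ∑ c, Kc c * ‖X c‖ := by
  classical
  have hb : ∀ b, ‖HM X b‖ ≤ ∑ c, |H (Pi.single c 1) b| * ‖X c‖ := by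
    intro b
    rw [hHM X b]
    refine (norm_sum_le _ _).trans (Finset.sum_le_sum fun c _ => ?_)
    rw [norm_smul, Real.norm_eq_abs]
  calc ∑ b, v b * ‖HM X b‖ ≤ ∑ b, v b * ∑ c, |H (Pi.single c 1) b| * ‖X c‖ :=
        Finset.sum_le_sum fun b _ => mul_le_mul_of_nonneg_left (hb b) (hv b)
    _ = ∑ c, (∑ b, v b * |H (Pi.single c 1) b|) * ‖X c‖ := by
        simp only [Finset.mul_sum, Finset.sum_mul]
        rw [Finset.sum_comm]
        exact Finset.sum_congr rfl fun c _ => Finset.sum_congr rfl fun b _ => by ring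
    _ ≤ ∑ c, Kc c * ‖X c‖ := Finset.sum_le_sum fun c _ => mul_le_mul_of_nonneg_right (hcol c) (norm_nonneg _)

end KernelExt

end Summit.QuantumFields.YangMills.Theorems.FlatHCurlCurlMatrix

end
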